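import Summits.BirchSwinnertonDyer.BirchSwinnertonDyer.Theorems.SchneiderFreeAdditiveX3NATResidualIndexAssembly
import Summits.BirchSwinnertonDyer.BirchSwinnertonDyer.Theorems.SchneiderFreeAdditiveX3NATIndexLocalHZero
import Summits.BirchSwinnertonDyer.BirchSwinnertonDyer.Theorems.EisensteinPrimesIndexInputsShellOfSurC
import Summits.BirchSwinnertonDyer.BirchSwinnertonDyer.Theorems.EisensteinPrimesIndexInputsH2OfTateTC
import Summits.BirchSwinnertonDyer.BirchSwinnertonDyer.Theorems.EisensteinPrimesAnticyclotomicLocalCdOne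
import Summits.BirchSwinnertonDyer.BirchSwinnertonDyer.Theorems.SchneiderFreeAdditiveX3SurLambdaCaseCTCHolds
import Summits.BirchSwinnertonDyer.BirchSwinnertonDyer.Theorems.SignedBaseChangeAnticyclotomicEisensteinDivisibilityLocalEulerPoincareCorank
import Literature.NumberTheory.IwasawaTheory.Greenberg2006.LocalH2VanishingOfLOC1
import Literature.NumberTheory.IwasawaTheory.Greenberg2006.GlobalEulerPoincareCorankOfTateTC
import Literature.NumberTheory.GaloisCohomology.TateGlobalEulerCharacteristicTotallyComplex
import Literature.NumberTheory.GaloisCohomology.RestrictedRamificationPoitouTateThreeLeTotallyComplex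
import Literature.NumberTheory.GaloisCohomology.RestrictedRamificationCdTwoBaseChange
import HarnessLib

/-!
# Route `SchneiderFreeAdditiveX3` (K1 door), crux r3 `GordTwoBranchIMC` (stmt-BirchSwinnertonDyer-19177): KELLER–YIN's λ-IDENTITY (arXiv:2402.12781
# Thm. 1.4.1 (iii)) FOR A RESIDUAL PAIR WITH BOTH CHARACTERS NON-TRIVIAL ON `D_v̄` — `λ(𝔛^{Sf}_{θsub}) + λ(𝔛^{Sf}_{θquot}) = λ(X_ac^{Sf}(W_K))` —
# from the V21 index road with NO NAMED HYPOTHESIS (no CGLS Prop. 1.2.5 / Cor. 1.2.6, no Greenberg, no Milne binder, no `cd ≤ 2` binder)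

Cell `bsd-schneider-ideate`, seat `bsd-schneider-door-c5` (prover, generation 43; assembly layer; `--supports` 19177, helper).  PARTITION: board row
B6 ∩ X3 ∩ sst-twist, `r = 1`, the (G-ord, `e = 2`) half of `Rank1Residual.partition` — the 686 NON-ANOMALOUS census pairs at `p = 3` and the 307 pairs at
`p ≥ 5` (and, class-wide, every additive semistable-twist pair whose two Jordan–Hölder characters are non-trivial on `D_v̄`, including crux r2's (M) cell at
`p ≥ 5`); types-the-object-of nothing new; closes none of B6's cells (BSD NOT advanced).  bears_on: K1-door (items 18971/18972/18974 retired since rev 3 → live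
crux r3 19177).  FILE C of this generation's NAT port of cell `bsd-eis`'s V21 index road (FILE A `…NATResidualIndexAssembly` p764900, FILE B `…NATIndexLocalHZero`).

## What

* §1 `zpCorank_datumStrictSelmer_eq_add_of_decomp_ne_one` — THE MID-LEVEL IDENTITY AT THE DOOR'S DATA: for `W/ℚ` globally minimal, `p` odd, `K` imaginary
  quadratic with the Heegner hypothesis for `N_W` and `(p) = v v̄` (`ι` inducing `v`), `W(K)[p] = 0`, `κ` anticyclotomic with topological generator `γ`,
  `(θsub, θquot)` a residual pair of `W_K[p]` with BOTH characters non-trivial on `D_v̄` (`hsubD`, `hquotD`), `Sf` the places over `N_W` (x1's convention), and the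
  cotorsion clauses (every `Sf`-imprimitive unramified dual datum of either character f.g. `Λ`-torsion with `μ = 0`; `X_ac^{Sf}(W_K)` f.g. `Λ`-torsion with
  `μ = 0`): **`zpCorank R(W_K[p^∞]) = zpCorank R((F/𝒪)(θsub)) + zpCorank R((F/𝒪)(θquot))`** (`R` = the strict residual-type Selmer groups `datumStrictSelmer
  (ker κ) · p (bdpData · p v̄) Sf`).  Composition: the residual line and its socle embeddings (`ResidualPairStableLine`), representatives (`IndexInputsReps`),
  SUR ×3 (`IndexInputsShell.sur_package_ofSurC` fed with the TREE theorems Greenberg 2016 Prop. 2.6.3 (c) at totally complex `K` — `SurLambda.prop263_sur_of_crk_caseC_tc_holds`,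
  this seat's F43 — Greenberg 2006 Props. 4.1/4.2/§5 A and Tate's global Euler characteristic at totally complex fields), COT ×6 (`IndexInputsCot`), the eleven
  `H⁰` conjuncts (FILE B), (U) ×4 (`IndexInputsH0`), the `H²` bookkeeping (`IndexInputsH2.natCard_H2_conjunct_ofTateTC`, `cd_p(G_{K,Σ}) ≤ 2` by
  `groupCdLE_two_galoisGroupUnramifiedOutside_holds`), DIV ×3 and LRS (`cd_p(ker κ ⊓ D_v̄) ≤ 1`, `AnticyclotomicLocalCdOne`), then FILE A; `ε = [θquot = 𝟙] = 0`
  under `hquotD`.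
* §2 `lambdaInvariant_add_eq_of_decomp_ne_one` — THE λ-IDENTITY: `λ(DSsub.X) + λ(DSquot.X) = λ(X_ac^{Sf}(W_K))` for ANY `Sf`-imprimitive unramified dual data
  `DSsub`, `DSquot` (plumbing: x1-w5's dictionary `λ(X_ac^{Sf}) = zpCorank R(W_K[p^∞])` and FILE B's (B2) for both characters — unramified = strict at `v̄` for a
  character non-trivial on `D_v̄`).  This is Keller–Yin Thm. 1.4.1 (iii) with `ε = s = 0` — an EQUALITY, where the anomalous twin (generations 31/40) only
  reaches `≤ … + ε`.
NO named hypothesis: every input of the road is a tree theorem here.  The door's two columns feed `hsubD`/`hquotD` in FILE E (`p = 3` non-anomalous: AUX3 +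
`a₃(V) ≢ 1 (mod 3)`; `p ≥ 5`: both characters ramified at `p`, F28a) and the cotorsion clauses from the [BR𝟙]/[BRω] roads (`p = 3`) / CGLS Prop. 1.2.5's
module clause (`p ≥ 5`).

HONEST FRAMING: compositions of tree theorems; no definition, no named fact, no `sorry`, no `Theses` import; nothing analytic; nothing about BSD or a main
conjecture is asserted; «closes rung: none».  References: [KellerYin2024] Prop. 1.3.2, Thm. 1.4.1, §1.4 (arXiv:2402.12781v2 TeX L919–953, L1087–1330);
[Greenberg2016Selmer] Prop. 2.6.3 (c); [Greenberg2006] Props. 3.2, 4.1, 4.2, §5 A; [MilneADT2006] I Thm. 4.10 (a), I Thm. 5.1; [NeukirchSchmidtWingberg2008]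
(8.3.18), (10.11.3); cell `bsd-eis` `…IndexInputsShellOfSurC`, `…IndexInputsH2OfTateTC`, `…AnticyclotomicLocalCdOne`, `…IndexPlumbingDictionary`; this seat F40a/F40b
(the anomalous templates), F43.
-/

set_option autoImplicit false
-- the route's Theorems namespace repeats the summit name by design (D-0017 nested layout)
set_option linter.dupNamespace false

noncomputable section

open scoped Classical

namespace Summit.BirchSwinnertonDyer.BirchSwinnertonDyer.Theorems.SchneiderFreeAdditiveX3.NATIndexIdentity

open NumberField IsDedekindDomain Field Multiplicative PowerSeries WeierstrassCurve
open Literature.NumberTheory.EllipticCurves Literature.NumberTheory.EllipticCurves.GreenbergSelmer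
  Literature.NumberTheory.EllipticCurves.GreenbergVatsal2000 Literature.NumberTheory.GaloisRepresentations
  Literature.NumberTheory.EllipticCurves.KellerYin2024 Literature.NumberTheory.EllipticCurves.IwasawaDual
  Literature.NumberTheory.EllipticCurves.Rank1Residual Literature.NumberTheory.EllipticCurves.Castella2018
  Literature.NumberTheory.QuadraticFields Literature.NumberTheory.EllipticCurves.IwasawaAlgebra
  Literature.NumberTheory.IwasawaTheory Literature.NumberTheory.IwasawaTheory.Greenberg2016
  Literature.NumberTheory.IwasawaTheory.Greenberg2006 Literature.NumberTheory.GaloisCohomology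
  Literature.NumberTheory.EllipticCurves.FineSelmerCoefficientMap
  Summit.BirchSwinnertonDyer.Rank1Residual.X2.ResidualDevissageModules
  Summit.BirchSwinnertonDyer.BirchSwinnertonDyer.Theorems
  Summit.BirchSwinnertonDyer.BirchSwinnertonDyer.Theorems.IndexInputsShell
  Summit.BirchSwinnertonDyer.BirchSwinnertonDyer.Theorems.SchneiderFreeAdditiveX3

variable {K : Type} [Field K] [NumberField K] {p : ℕ} [hp : Fact p.Prime]

/-! ## §1. The mid-level identity at the door's data, no named hypothesis -/

/-- **THE MID-LEVEL IDENTITY OF THE V21 INDEX ROAD AT THE DOOR'S DATA, «no local fixed vectors» orientation, NO NAMED HYPOTHESIS:**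
`zpCorank R(W_K[p^∞]) = zpCorank R((F/𝒪)(θsub)) + zpCorank R((F/𝒪)(θquot))` (strict residual-type Selmer groups over `K_∞`, `Sf` = the places over `N_W`).
See the module docstring for the binders and the composition.  [cite: KellerYin2024, Prop. 1.3.2, Thm. 1.4.1 (iii), §1.4 (arXiv:2402.12781v2 TeX L919–953, L1087–1330)]
[cite: Greenberg2016Selmer, Prop. 2.6.3 (c)] [cite: Greenberg2006, Props. 3.2, 4.1, 4.2, §5 A] [cite: MilneADT2006, I Thm. 4.10 (a), I Thm. 5.1] [cite: NeukirchSchmidtWingberg2008, (8.3.18)] -/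
theorem zpCorank_datumStrictSelmer_eq_add_of_decomp_ne_one
    (W : WeierstrassCurve ℚ) [W.IsElliptic] [W.IsGloballyMinimal] (hp2 : 2 < p)
    (K : Type) [Field K] [NumberField K] (hK : IsImaginaryQuadratic K)
    (hH : SatisfiesHeegnerHypothesis (W.conductorNorm ℤ) K)
    (htor : ∀ Q : (W.baseChange K).toAffine.Point, p • Q = 0 → Q = 0)
    (ι : K →+* ℚ_[p]) (v vbar : HeightOneSpectrum (𝓞 K))
    (hv : ∀ x : 𝓞 K, x ∈ v.asIdeal ↔ ‖ι (x : K)‖ < 1)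
    (hvbar : ((p : ℕ) : 𝓞 K) ∈ vbar.asIdeal) (hne : vbar ≠ v)
    (κ : ZpExtension K p) (hκ : κ.IsAnticyclotomic)
    (γ : absoluteGaloisGroup K) [Fact (κ.IsTopGenerator γ)]
    (θsub θquot : FramedGaloisRep K (padicCoeffIntegers (∅ : Set (PadicAlgCl p))) 1)
    (hpair : IsResidualPairOver (W.baseChange K) p θsub θquot)
    (hsubD : ∃ τ ∈ decomp vbar, unitChar θsub τ ≠ 1) (hquotD : ∃ τ ∈ decomp vbar, unitChar θquot τ ≠ 1)
    (Sf : Finset (HeightOneSpectrum (𝓞 K)))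
    (hSf : ∀ w : HeightOneSpectrum (𝓞 K), w ∈ Sf ↔ ((W.conductorNorm ℤ : ℤ) : 𝓞 K) ∈ w.asIdeal)
    (hfgS : Module.Finite (IwasawaAlgebra p) (AcSelmer.XAc (W.baseChange K) p κ vbar (↑Sf : Set (HeightOneSpectrum (𝓞 K))) γ))
    (htorS : Module.IsTorsion (IwasawaAlgebra p) (AcSelmer.XAc (W.baseChange K) p κ vbar (↑Sf : Set (HeightOneSpectrum (𝓞 K))) γ))
    (hμS : muInvariant p (AcSelmer.XAc (W.baseChange K) p κ vbar (↑Sf : Set (HeightOneSpectrum (𝓞 K))) γ) = 0)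
    (hSsub : ∀ D : DatumDualData κ γ (charModule ∅ θsub)
        (AcSelmer.bdpData (charModule ∅ θsub) p vbar) (↑Sf : Set (HeightOneSpectrum (𝓞 K))),
      Module.Finite (IwasawaAlgebra p) D.X ∧ Module.IsTorsion (IwasawaAlgebra p) D.X ∧ muInvariant p D.X = 0)
    (hSquot : ∀ D : DatumDualData κ γ (charModule ∅ θquot)
        (AcSelmer.bdpData (charModule ∅ θquot) p vbar) (↑Sf : Set (HeightOneSpectrum (𝓞 K))),
      Module.Finite (IwasawaAlgebra p) D.X ∧ Module.IsTorsion (IwasawaAlgebra p) D.X ∧ muInvariant p D.X = 0) :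
    zpCorank (datumStrictSelmer κ.kerSubgroup ↥((W.baseChange K).geomPrimaryTorsion p) p
        (AcSelmer.bdpData ↥((W.baseChange K).geomPrimaryTorsion p) p vbar) (↑Sf : Set (HeightOneSpectrum (𝓞 K)))) p =
      zpCorank (datumStrictSelmer κ.kerSubgroup (charModule ∅ θsub) p (AcSelmer.bdpData (charModule ∅ θsub) p vbar)
          (↑Sf : Set (HeightOneSpectrum (𝓞 K)))) p +
        zpCorank (datumStrictSelmer κ.kerSubgroup (charModule ∅ θquot) p
          (AcSelmer.bdpData (charModule ∅ θquot) p vbar) (↑Sf : Set (HeightOneSpectrum (𝓞 K)))) p := by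
  -- the named inputs of cell `bsd-eis`'s producers, ALL tree theorems
  have h263 : prop263_sur_of_crk_caseC_tc := SurLambda.prop263_sur_of_crk_caseC_tc_holds
  have h41 : prop41_globalEulerPoincareCorank :=
    Greenberg2006.prop41_of_tate_of_poitouTate_three_le_of_isTotallyComplex
      forall_tateGlobalEulerPoincareCharacteristic_of_isTotallyComplex forall_poitouTate_restricted_three_le_of_isTotallyComplex
  have h42 : prop42_localEulerPoincareCorank := Greenberg2006.prop42_localEulerPoincareCorank_holds
  have h5A : sec5A_localH2_subsingleton_of_LOC1 := Greenberg2006.sec5A_localH2_subsingleton_of_LOC1_holds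
  have h32 := forall_tateGlobalEulerPoincareCharacteristic_of_isTotallyComplex
  have hCD2 : groupCdLE_two_galoisGroupUnramifiedOutside K := groupCdLE_two_galoisGroupUnramifiedOutside_holds K
  haveI hEK : (W.baseChange K).IsElliptic := inferInstanceAs (W.map (algebraMap ℚ K)).IsElliptic
  have hγ : κ.IsTopGenerator γ := Fact.out
  have hp : p ≠ 2 := by omega
  have hpvK : ((p : ℕ) : 𝓞 K) ∈ v.asIdeal := IndexPlumbingNrVsStrict.natCast_mem_asIdeal_of_forall_norm_iff hv
  have hθsub : ∀ σ : absoluteGaloisGroup K, θsub σ ^ (p - 1) = 1 := fun σ ↦ (hpair.pow_sub_one σ).1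
  have hθquot : ∀ σ : absoluteGaloisGroup K, θquot σ ^ (p - 1) = 1 := fun σ ↦ (hpair.pow_sub_one σ).2
  -- the residual line with its socle embeddings
  obtain ⟨Φ, hSub, hQuot, ⟨j₁, hj₁, hj₁inj, hr₁⟩, ⟨j₃, hj₃, hj₃inj, hr₃⟩⟩ :=
    ResidualPairStableLine.exists_stableLine_of_isResidualPairOver (W.baseChange K) hpair
  -- the exponent `c` and the representatives `γ ^ i`
  obtain ⟨c, hc, hcd⟩ := IndexInputsReps.exists_pow_generates_decomp_of_isImaginaryQuadratic κ hK hvbar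
  obtain ⟨-, -, hreps⟩ := IndexInputsReps.reps_package_of_pow_generates κ vbar hγ hc hcd
  -- SUR ×3 (x1's package, reduction-free, fed with tree theorems)
  obtain ⟨hsur₁, hsur₂, hsur₃⟩ := sur_package_ofSurC h263 h41 h42 h5A h32 W p hp2 K hK hH ι v vbar hv hvbar hne κ hκ γ θsub θquot hpair Sf
    hSf hSsub hSquot c hc hcd
  -- COT ×6
  obtain ⟨hprim₁, hfin₁⟩ := IndexInputsCot.isPrimary_and_finite_torsionBy_datumStrictSelmer_charModule_of_forall p vbar κ
    γ θsub (↑Sf : Set (HeightOneSpectrum (𝓞 K))) hSsub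
  obtain ⟨hprim₃, hfin₃⟩ := IndexInputsCot.isPrimary_and_finite_torsionBy_datumStrictSelmer_charModule_of_forall p vbar κ
    γ θquot (↑Sf : Set (HeightOneSpectrum (𝓞 K))) hSquot
  haveI := hfgS
  obtain ⟨hprim₂, hfin₂⟩ := IndexInputsCot.isPrimary_and_finite_torsionBy_datumStrictSelmer_curve W p K vbar κ Sf hK hvbar
    γ hSf htorS hμS
  haveI := hfin₁; haveI := hfin₂; haveI := hfin₃
  -- H⁰ ×11 («no local fixed vectors», FILE B)
  obtain ⟨hinv₁, hinv₂, hinv₃, hN₂, hfinq, hε, -, hN₃D, hinvD₁, hinvD₂, hinvD₃⟩ :=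
    NATIndexLocalHZero.hZero_package_of_noLocalFixed W p K htor vbar κ θsub θquot hpair hsubD hquotD Φ hQuot j₁ hj₁ hj₁inj j₃ hj₃
      hj₃inj
  haveI := hfinq
  -- the curve-side Kummer conjuncts
  have hr₂ : ∀ x : ↥((W.baseChange K).geomPrimaryTorsion p),
      x ∈ (AddSubgroup.inclusion (geomTorsion_le_geomPrimaryTorsion (W.baseChange K) p)).range ↔ p • x = 0 := by
    intro x
    constructor
    · rintro ⟨y, rfl⟩
      apply Subtype.ext
      rw [AddSubgroupClass.coe_nsmul, AddSubgroup.coe_inclusion, ZeroMemClass.coe_zero, ← natCast_zsmul]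
      exact (Submodule.mem_torsionBy_iff _ _).mp y.2
    · intro hx
      have hx' : (p : ℤ) • (x : geomPoints (W.baseChange K)) = 0 := by
        rw [natCast_zsmul, ← AddSubgroupClass.coe_nsmul, hx, ZeroMemClass.coe_zero]
      exact ⟨⟨(x : geomPoints (W.baseChange K)), (Submodule.mem_torsionBy_iff _ _).mpr hx'⟩, Subtype.ext rfl⟩
  have hd₂ : ∀ x : ↥((W.baseChange K).geomPrimaryTorsion p), ∃ x' : ↥((W.baseChange K).geomPrimaryTorsion p),
      p • x' = x :=
    (W.baseChange K).exists_nsmul_eq_geomPrimaryTorsion p (W.baseChange K).zsmul_geomPoints_surjective_holds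
  -- H² (x1-p1-w4 g5, reduction-free; `cd_p ≤ 2` a tree theorem)
  have hH2 := IndexInputsH2.natCard_H2_conjunct_ofTateTC hCD2 h41 h42 h5A h32 W hp2 hK hH hv hvbar hne κ hκ γ hpair Sf hSf hSsub hSquot Φ
    j₁ j₃ hj₁ hj₃ hj₁inj hj₃inj hr₁ hr₃
  -- continuity of the orbit maps of `W_K[p]`
  have hcN₂ : ∀ b : ↥((W.baseChange K).geomTorsion (p : ℤ)), Continuous fun σ : absoluteGaloisGroup K ↦ σ • b :=
    fun b ↦ continuous_of_injective_comp (G := absoluteGaloisGroup K) Subtype.val_injective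
      ((W.baseChange K).continuous_smul_geomPoints (b : geomPoints (W.baseChange K)))
  -- DIV ×3 and LRS: `cd_p(ker κ ⊓ D_v̄) ≤ 1` (x1-p1-w4 gen 3, `AnticyclotomicLocalCdOne`)
  have hneD : ∃ τ ∈ decomp (K := K) vbar, κ τ ≠ 1 :=
    AnticyclotomicLocalCdOne.exists_mem_decomp_apply_ne_one_of_isAnticyclotomic κ vbar hK hp hκ hvbar
  have hdiv₁ : ∀ y : subgroupH1 (κ.kerSubgroup ⊓ decomp vbar) (charModule ∅ θsub), ∃ y', p • y' = y := fun y ↦ by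
    obtain ⟨y', hy'⟩ := AnticyclotomicLocalCdOne.exists_eq_nsmul_subgroupH1_inf_decomp κ vbar hneD
      (CharResidualSelmerCount.continuous_smul_charModule θsub) (CharResidualSelmerCount.charModule_divisible θsub) y
    exact ⟨y', hy'.symm⟩
  have hdiv₂ : ∀ y : subgroupH1 (κ.kerSubgroup ⊓ decomp vbar) ↥((W.baseChange K).geomPrimaryTorsion p),
      ∃ y', p • y' = y := fun y ↦ by
    obtain ⟨y', hy'⟩ := AnticyclotomicLocalCdOne.exists_eq_nsmul_subgroupH1_inf_decomp κ vbar hneD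
      ((W.baseChange K).continuous_smul_geomPrimaryTorsion p) hd₂ y
    exact ⟨y', hy'.symm⟩
  have hdiv₃ : ∀ y : subgroupH1 (κ.kerSubgroup ⊓ decomp vbar) (charModule ∅ θquot), ∃ y', p • y' = y := fun y ↦ by
    obtain ⟨y', hy'⟩ := AnticyclotomicLocalCdOne.exists_eq_nsmul_subgroupH1_inf_decomp κ vbar hneD
      (CharResidualSelmerCount.continuous_smul_charModule θquot) (CharResidualSelmerCount.charModule_divisible θquot) y
    exact ⟨y', hy'.symm⟩
  have hpQ : ∀ Q : ↥((W.baseChange K).geomTorsion (p : ℤ)), p • Q = 0 := fun Q ↦ by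
    apply Subtype.ext
    have h := (mem_geomTorsion_iff (W.baseChange K) (p : ℤ) (Q : geomPoints (W.baseChange K))).mp Q.2
    rw [AddSubmonoidClass.coe_nsmul, ← natCast_zsmul, h]
    rfl
  have hlrs := AnticyclotomicLocalCdOne.resH1Hom_id_surjective_inf_decomp κ vbar hneD
    (fun a ↦ Φ.continuous_smul_sub hcN₂ a) hcN₂ (fun a ↦ Φ.continuous_smul_quot hcN₂ a)
    (fun n ↦ ⟨1, Φ.incl_injective (by rw [map_nsmul, map_zero, pow_one]; exact hpQ _)⟩)
    Φ.incl Φ.incl_smul Φ.incl_injective Φ.proj Φ.proj_smul Φ.proj_incl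
    (fun b hb ↦ Φ.mem_range_incl_of_proj_eq_zero b hb) Φ.proj_surjective
  -- the MID-LEVEL identity in the «no local fixed vectors» orientation (FILE A)
  have hmid := NATIndexAssembly.zpCorank_datumStrictSelmer_add_eq_of_noLocalFixed κ.kerSubgroup p
    (↑Sf : Set (HeightOneSpectrum (𝓞 K))) vbar hvbar Φ.incl Φ.proj Φ.incl_smul Φ.proj_smul Φ.incl_injective
    Φ.proj_surjective (fun b hb ↦ Φ.mem_range_incl_of_proj_eq_zero b hb) Φ.proj_incl j₁
    (AddSubgroup.inclusion (geomTorsion_le_geomPrimaryTorsion (W.baseChange K) p)) j₃ hj₁ (fun _ _ ↦ rfl) hj₃ hj₁inj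
    (AddSubgroup.inclusion_injective _) hj₃inj hr₁ hr₂ hr₃ (CharResidualSelmerCount.charModule_divisible θsub) hd₂
    (CharResidualSelmerCount.charModule_divisible θquot) (fun a ↦ Φ.continuous_smul_sub hcN₂ a) hcN₂
    (fun a ↦ Φ.continuous_smul_quot hcN₂ a) (CharResidualSelmerCount.continuous_smul_charModule θsub)
    ((W.baseChange K).continuous_smul_geomPrimaryTorsion p) (CharResidualSelmerCount.continuous_smul_charModule θquot)
    (fun w hw hpw ↦ IndexInputsH0.injective_resH1Hom_inertiaIn_incl W κ.kerSubgroup Sf hSf Φ w hw hpw)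
    (fun w _ _ ↦ IndexInputsH0.injective_resH1Hom_inertiaIn_of_charModule κ.kerSubgroup θsub hθsub j₁ hj₁ hj₁inj hr₁ w)
    (fun w hw hpw ↦ IndexInputsH0.injective_resH1Hom_inertiaIn_inclusion W κ.kerSubgroup Sf hSf w hw hpw)
    (fun w _ _ ↦ IndexInputsH0.injective_resH1Hom_inertiaIn_of_charModule κ.kerSubgroup θquot hθquot j₃ hj₃ hj₃inj hr₃ w)
    c (fun i : ℕ ↦ γ ^ i) (hreps _) (hreps _) (hreps _) hsur₁ hsur₂ hsur₃ hdiv₁ hdiv₂ hdiv₃ hlrs hprim₁ hprim₂ hprim₃ hinv₁ hinv₂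
    hinv₃ hN₂ hε hN₃D hinvD₁ hinvD₂ hinvD₃ hH2
  rw [NATIndexLocalHZero.indicator_eq_zero_of_exists_unitChar_ne_one vbar θquot hquotD, add_zero] at hmid
  exact hmid

/-! ## §2. Keller–Yin Thm. 1.4.1 (iii) as an EQUALITY for a pair with both characters non-trivial on `D_v̄` -/

/-- **KELLER–YIN's λ-IDENTITY for a residual pair with BOTH characters non-trivial on `D_v̄`, no named hypothesis:**
`λ(DSsub.X) + λ(DSquot.X) = λ(X_ac^{Sf}(W_K))` for any `Sf`-imprimitive unramified dual data `DSsub`, `DSquot` (`Sf` = the places over `N_W`, x1's convention;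
binders and cotorsion clauses as in §1).  §1 + x1-w5's dictionary `λ(X_ac^{Sf}) = zpCorank R(W_K[p^∞])` + FILE B's (B2) for both characters (unramified = strict
at `v̄` for a character non-trivial on `D_v̄`).  [cite: KellerYin2024, Thm. 1.4.1 (iii) (arXiv:2402.12781v2 TeX L1087–1098) (with `ε = s = 0`)]
[cite: GreenbergLNM1716, §1 p. 60] [cite: CastellaGrossiLeeSkinner2022, proof of Thm. 1.2.2 (strict = unramified for `θ|_{G_v̄} ≠ 𝟙`)] -/
theorem lambdaInvariant_add_eq_of_decomp_ne_one
    (W : WeierstrassCurve ℚ) [W.IsElliptic] [W.IsGloballyMinimal] (hp2 : 2 < p)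
    (K : Type) [Field K] [NumberField K] (hK : IsImaginaryQuadratic K)
    (hH : SatisfiesHeegnerHypothesis (W.conductorNorm ℤ) K)
    (htor : ∀ Q : (W.baseChange K).toAffine.Point, p • Q = 0 → Q = 0)
    (ι : K →+* ℚ_[p]) (v vbar : HeightOneSpectrum (𝓞 K))
    (hv : ∀ x : 𝓞 K, x ∈ v.asIdeal ↔ ‖ι (x : K)‖ < 1)
    (hvbar : ((p : ℕ) : 𝓞 K) ∈ vbar.asIdeal) (hne : vbar ≠ v)
    (κ : ZpExtension K p) (hκ : κ.IsAnticyclotomic)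
    (γ : absoluteGaloisGroup K) [Fact (κ.IsTopGenerator γ)]
    (θsub θquot : FramedGaloisRep K (padicCoeffIntegers (∅ : Set (PadicAlgCl p))) 1)
    (hpair : IsResidualPairOver (W.baseChange K) p θsub θquot)
    (hsubD : ∃ τ ∈ decomp vbar, unitChar θsub τ ≠ 1) (hquotD : ∃ τ ∈ decomp vbar, unitChar θquot τ ≠ 1)
    (Sf : Finset (HeightOneSpectrum (𝓞 K)))
    (hSf : ∀ w : HeightOneSpectrum (𝓞 K), w ∈ Sf ↔ ((W.conductorNorm ℤ : ℤ) : 𝓞 K) ∈ w.asIdeal)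
    (DSsub : DatumDualData κ γ (charModule ∅ θsub)
        (AcSelmer.bdpData (charModule ∅ θsub) p vbar) (↑Sf : Set (HeightOneSpectrum (𝓞 K))))
    (DSquot : DatumDualData κ γ (charModule ∅ θquot)
        (AcSelmer.bdpData (charModule ∅ θquot) p vbar) (↑Sf : Set (HeightOneSpectrum (𝓞 K))))
    (hfgS : Module.Finite (IwasawaAlgebra p) (AcSelmer.XAc (W.baseChange K) p κ vbar (↑Sf : Set (HeightOneSpectrum (𝓞 K))) γ))
    (htorS : Module.IsTorsion (IwasawaAlgebra p) (AcSelmer.XAc (W.baseChange K) p κ vbar (↑Sf : Set (HeightOneSpectrum (𝓞 K))) γ))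
    (hμS : muInvariant p (AcSelmer.XAc (W.baseChange K) p κ vbar (↑Sf : Set (HeightOneSpectrum (𝓞 K))) γ) = 0)
    (hSsub : ∀ D : DatumDualData κ γ (charModule ∅ θsub)
        (AcSelmer.bdpData (charModule ∅ θsub) p vbar) (↑Sf : Set (HeightOneSpectrum (𝓞 K))),
      Module.Finite (IwasawaAlgebra p) D.X ∧ Module.IsTorsion (IwasawaAlgebra p) D.X ∧ muInvariant p D.X = 0)
    (hSquot : ∀ D : DatumDualData κ γ (charModule ∅ θquot)
        (AcSelmer.bdpData (charModule ∅ θquot) p vbar) (↑Sf : Set (HeightOneSpectrum (𝓞 K))),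
      Module.Finite (IwasawaAlgebra p) D.X ∧ Module.IsTorsion (IwasawaAlgebra p) D.X ∧ muInvariant p D.X = 0) :
    lambdaInvariant p DSsub.X + lambdaInvariant p DSquot.X =
      lambdaInvariant p (AcSelmer.XAc (W.baseChange K) p κ vbar (↑Sf : Set (HeightOneSpectrum (𝓞 K))) γ) := by
  have hθsub : ∀ σ : absoluteGaloisGroup K, θsub σ ^ (p - 1) = 1 := fun σ ↦ (hpair.pow_sub_one σ).1
  have hθquot : ∀ σ : absoluteGaloisGroup K, θquot σ ^ (p - 1) = 1 := fun σ ↦ (hpair.pow_sub_one σ).2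
  -- the mid-level identity (§1)
  have hmid := zpCorank_datumStrictSelmer_eq_add_of_decomp_ne_one W hp2 K hK hH htor ι v vbar hv hvbar hne κ hκ γ θsub θquot hpair hsubD
    hquotD Sf hSf hfgS htorS hμS hSsub hSquot
  -- (C): `λ(X_ac^{Sf}) = zpCorank R(W_K[p^∞])`
  haveI := hfgS
  obtain ⟨-, hC⟩ := IndexPlumbingDictionary.finite_torsionBy_and_lambdaInvariant_XAc_eq_zpCorank_datumStrictSelmer
    W p K vbar κ Sf hK hvbar γ hSf htorS hμS
  -- (B2) for both characters: `λ(DS.X) = zpCorank R(θ)` (unramified = strict at `v̄`)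
  have hB₁ := NATIndexLocalHZero.lambdaInvariant_eq_zpCorank_grSelmer_of_decomp_ne_one_of_forall κ vbar
    (↑Sf : Set (HeightOneSpectrum (𝓞 K))) θsub hθsub hsubD DSsub hSsub
  have hB₃ := NATIndexLocalHZero.lambdaInvariant_eq_zpCorank_grSelmer_of_decomp_ne_one_of_forall κ vbar
    (↑Sf : Set (HeightOneSpectrum (𝓞 K))) θquot hθquot hquotD DSquot hSquot
  change lambdaInvariant p DSsub.X = zpCorank ↥(datumStrictSelmer κ.kerSubgroup (charModule ∅ θsub) p
    (AcSelmer.bdpData (charModule ∅ θsub) p vbar) (↑Sf : Set (HeightOneSpectrum (𝓞 K)))) p at hB₁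
  change lambdaInvariant p DSquot.X = zpCorank ↥(datumStrictSelmer κ.kerSubgroup (charModule ∅ θquot) p
    (AcSelmer.bdpData (charModule ∅ θquot) p vbar) (↑Sf : Set (HeightOneSpectrum (𝓞 K)))) p at hB₃
  rw [hB₁, hB₃, hC, hmid]

end Summit.BirchSwinnertonDyer.BirchSwinnertonDyer.Theorems.SchneiderFreeAdditiveX3.NATIndexIdentity

end
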